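import Literature.Probability.LatticeModels.LatticeDobrushinBox
import Literature.Probability.LatticeModels.FKPrimitiveBounds
import Literature.Probability.LatticeModels.FKPrimitiveBoundaryLaplacian
import Literature.Probability.LatticeModels.FKExplorationDomainMarkov
import HarnessLib

/-!
# The FK observable in the bar domain: levels of the primitive, the source under the bar, and the flux at the bottom

Topic `Literature/Probability/LatticeModels`; the observable side of Duminil-Copin–Hongler–Nolin's
Proposition 13 (the first-moment estimate of the RSW proof for the critical FK-Ising model,
arXiv:0912.4253 §4), carried out in the *bar domain* `LatticeDobrushin.barDomain W N c` of
`LatticeDobrushinBox.lean` (the rectangle `R = [0, W] × [0, N]` plus the ring around it, wired arc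
= the bar `[c, c+3] × {N+1}` of the top ring row, the rest of the ring free) with the tree's exact
rendering of Smirnov's primitive `H = Im ∫ F²` (`IsFKPrimitive`, `FKPrimitive*.lean`).
Everything here is PROVED (0 new facts).

* Geometry of the bar domain for the primitive: `isInteriorEdge_barDomain` (edges from `R` into
  `R ∪ bar` are interior), `mem_interiorFaces_barDomain` (faces of `R` are interior faces),
  `exists_isInnerFace_of_adj` (adjacent sites corner a common inner face),
  `reflTransGen_zdArcB_barDomain` / `reflTransGen_bar` (the free arc and the bar are connected by
  lattice steps).
* Levels (DCHN §3.1, Smirnov Lemma 4.11): for a primitive `(Hw, Hb)`, `Hw` is constant on the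
  free arc (`hw_eq_of_mem_zdArcB`, value `H_B`) and on the bar (`hw_eq_of_mem_bar`, value `H_A`),
  `H_B = H_A + 1` (`levelB_eq`), `Hb ≤ H_B` on inner faces and `H_A ≤ Hw` (`hb_le_levelB`,
  `levelA_le_hw`, from `FKPrimitiveBounds`).
* **`window_source`** (the boundary modification trick of DCHN Proposition 8, quantified by the
  black phantom inequality `phantom_laplacian_hb`): at the three faces `(c+j, N)` under the bar,
  `H_B - Hb ≥ (1 - τ)/(4 - τ)`, `τ = (√2 - 1)² = tan²(π/8)`.
* **`DiscreteDobrushin.dartFlux_le_openJoined_sq`** (DCHN Lemma 12, lower half, generic domain):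
  for a dart whose edge ends on the free arc, `|F(e)|² ≤ P(e ∈ γ)² ≤ P(x ↔ A by open edges)²`
  (`OpenJoinedToArcA`; the interface passes `e` only if its primal end `x` is an explored wired
  vertex, and those hang off `A` by revealed open edges — `FKExplorationDomainMarkov`).
* `levelB_sub_hb_le_dartFlux`: at a bottom-row site `x = (x₁, 0)` of `R`, the flux of the dart
  from `x` down to the free arc is `H_B - Hw(x) ≥ H_B - Hb(x₁, 0)`.

The potential-theoretic lower bound `H_B - Hb(x₁, 0) ≥ κ/(W+1)²` (comparison with the sine-series
barrier of `BoxSineHarmonic.lean`) and the resulting `P(x ↔ bar)² ≥ κ/(W+1)²` follow in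
`FKIsingBarHarmonicBound.lean`.

## References

* H. Duminil-Copin, C. Hongler, P. Nolin, *Connection probabilities and RSW-type bounds for the
  two-dimensional FK Ising model*, Comm. Pure Appl. Math. 64 (2011), §3.1 (Prop. 8), §3.2
  (Lemma 12), §4 (Prop. 13) — bib key `DuminilCopinHonglerNolin2011`.
* S. Smirnov, *Conformal invariance in random cluster models. I*, Ann. Math. 172 (2010), §3–§4.
* H. Duminil-Copin, S. Smirnov, *Conformal invariance of lattice models*, Clay Math. Proc. 15
  (2012), §6.2 — bib key `DuminilCopinSmirnov2012Clay`.
-/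

namespace Literature.Probability.LatticeModels

open Finset Set SimpleGraph

namespace LatticeDobrushin

variable {W N : ℕ} {c : ℤ}

/-! ### Coordinates of faces and corners -/

/-- The faces at a site of the rectangle `R = [0, W] × [0, N]` are inner faces of the bar domain. [folklore] -/
theorem isInnerFace_faceAt_barDomain {u : Site 2} (hu : 0 ≤ u 0 ∧ u 0 ≤ (W : ℤ) ∧ 0 ≤ u 1 ∧ u 1 ≤ (N : ℤ)) (k : Fin 4) :
    (barDomain W N c).toDobrushin.IsInnerFace (faceAt u k) := by
  rw [isInnerFace_barDomain_iff]
  have h0 := cornerOff_apply_zero_or_one k 0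
  have h1 := cornerOff_apply_zero_or_one k 1
  simp only [faceAt, Pi.sub_apply]
  omega

/-- **Interior edges of the bar domain**: every edge from a site of `R` to a site of `R` or of the
bar is interior in Smirnov's sense. [folklore] -/
theorem isInteriorEdge_barDomain (hc : 0 ≤ c) (hcW : c + 3 ≤ W) {u : Site 2}
    (hu : 0 ≤ u 0 ∧ u 0 ≤ (W : ℤ) ∧ 0 ≤ u 1 ∧ u 1 ≤ (N : ℤ)) {k : Fin 4}
    (hv : (0 ≤ (u + cornerUnit k) 0 ∧ (u + cornerUnit k) 0 ≤ (W : ℤ) ∧ 0 ≤ (u + cornerUnit k) 1 ∧ (u + cornerUnit k) 1 ≤ (N : ℤ)) ∨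
      u + cornerUnit k ∈ (barDomain W N c).A) :
    (barDomain W N c).toDobrushin.IsInteriorEdge u k := by
  have huS : u ∈ (barDomain W N c).S := by rw [mem_barDomain_S]; omega
  have hvS : u + cornerUnit k ∈ (barDomain W N c).S := by
    rcases hv with hv | hv
    · rw [mem_barDomain_S]; omega
    · exact (barDomain W N c).A_subset hv
  have huB : u ∉ (barDomain W N c).toDobrushin.zdArcB := by
    rw [zdArcB_barDomain hc hcW]; rintro ⟨-, hring, -⟩; omega
  have hvB : u + cornerUnit k ∉ (barDomain W N c).toDobrushin.zdArcB := by
    rw [zdArcB_barDomain hc hcW]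
    rintro ⟨-, hring, hnot⟩
    rcases hv with hv | hv
    · omega
    · exact hnot (mem_barDomain_A.1 hv).2
  have huA : u ∉ (barDomain W N c).toDobrushin.zdArcA := by
    rw [zdArcA_barDomain hc hcW]; intro h; have := (mem_barDomain_A.1 h).2.1; omega
  refine ⟨?_, ?_, fun h => huA h.1, isInnerFace_faceAt_barDomain hu k, isInnerFace_faceAt_barDomain hu (k + 3)⟩
  · exact (barDomain W N c).mem_edgeSet_iff.2 ⟨(SimpleGraph.mem_edgeSet _).1 (cSrc_mem_edgeSet (u, k)), huS, hvS⟩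
  · intro x hx
    simp only [cSrc, Sym2.mem_iff] at hx
    rcases hx with rfl | rfl
    · exact huB
    · exact hvB

/-- The faces of `R` (lower-left corners in `[0, W-1] × [0, N-1]`) are interior faces. [folklore] -/
theorem mem_interiorFaces_barDomain (hc : 0 ≤ c) (hcW : c + 3 ≤ W) {f : Site 2}
    (hf : 0 ≤ f 0 ∧ f 0 + 1 ≤ (W : ℤ) ∧ 0 ≤ f 1 ∧ f 1 + 1 ≤ (N : ℤ)) :
    f ∈ (barDomain W N c).toDobrushin.interiorFaces := by
  intro j
  have h0 := cornerOff_apply_zero_or_one j 0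
  have h1 := cornerOff_apply_zero_or_one j 1
  have h0' := cornerOff_apply_zero_or_one (j + 1) 0
  have h1' := cornerOff_apply_zero_or_one (j + 1) 1
  have hsum : ∀ i, cornerOff j i + cornerUnit j i = cornerOff (j + 1) i := fun i => by
    have := congrFun (cornerUnit_eq_off_sub j) i
    simp only [Pi.sub_apply] at this
    omega
  have hs0 := hsum 0
  have hs1 := hsum 1
  refine isInteriorEdge_barDomain hc hcW ?_ (Or.inl ?_)
  · simp only [Pi.add_apply]; omega
  · simp only [Pi.add_apply]; omega

/-! ### Adjacent sites share an inner face -/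

/-- **Two adjacent sites of the bar domain are corners of a common inner face.** [folklore] -/
theorem exists_isInnerFace_of_adj {x y : Site 2} (hx : x ∈ (barDomain W N c).S) (hy : y ∈ (barDomain W N c).S)
    (hxy : (zdGraph 2).Adj x y) :
    ∃ f, (barDomain W N c).toDobrushin.IsInnerFace f ∧ IsCorner x f ∧ IsCorner y f := by
  rw [mem_barDomain_S] at hx hy
  -- reduce to `y = x + eᵢ`
  suffices key : ∀ x y : Site 2, (-1 ≤ x 0 ∧ x 0 ≤ (W : ℤ) + 1 ∧ -1 ≤ x 1 ∧ x 1 ≤ (N : ℤ) + 1) →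
      (-1 ≤ y 0 ∧ y 0 ≤ (W : ℤ) + 1 ∧ -1 ≤ y 1 ∧ y 1 ≤ (N : ℤ) + 1) → ∀ i : Fin 2, y = x + Pi.single i 1 →
      ∃ f, (barDomain W N c).toDobrushin.IsInnerFace f ∧ IsCorner x f ∧ IsCorner y f by
    obtain ⟨i, hi | hi⟩ := (zdGraph_adj_iff x y).1 hxy
    · exact key x y hx hy i hi
    · obtain ⟨f, hf, h1, h2⟩ := key y x hy hx i hi
      exact ⟨f, hf, h2, h1⟩
  intro x y hx hy i hi
  subst hi
  simp only [Pi.add_apply, Pi.single_apply] at hy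
  fin_cases i
  · -- horizontal edge: the face above (`x`) or below (`x - e₁`)
    by_cases h : x 1 ≤ N
    · refine ⟨x, isInnerFace_barDomain_iff.2 (by simp at hy; omega), (isCorner_and_isCorner_add_e0_iff.2 (Or.inl rfl)).1,
        (isCorner_and_isCorner_add_e0_iff.2 (Or.inl rfl)).2⟩
    · refine ⟨x - Pi.single 1 1, isInnerFace_barDomain_iff.2 (by simp at hy ⊢; omega),
        (isCorner_and_isCorner_add_e0_iff.2 (Or.inr rfl)).1, (isCorner_and_isCorner_add_e0_iff.2 (Or.inr rfl)).2⟩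
  · -- vertical edge: the face to the right (`x`) or to the left (`x - e₀`)
    by_cases h : x 0 ≤ W
    · refine ⟨x, isInnerFace_barDomain_iff.2 (by simp at hy; omega), (isCorner_and_isCorner_add_e1_iff.2 (Or.inl rfl)).1,
        (isCorner_and_isCorner_add_e1_iff.2 (Or.inl rfl)).2⟩
    · refine ⟨x - Pi.single 0 1, isInnerFace_barDomain_iff.2 (by simp at hy ⊢; omega),
        (isCorner_and_isCorner_add_e1_iff.2 (Or.inr rfl)).1, (isCorner_and_isCorner_add_e1_iff.2 (Or.inr rfl)).2⟩

/-! ### The primitive is constant on each arc -/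

section Primitive

variable (hc : 0 ≤ c) (hcW : c + 3 ≤ W) {Hw Hb : Site 2 → ℝ}
  (h : IsFKPrimitive (barDomain W N c).toDobrushin (isZdAdmissible_barDomain hc hcW) Hw Hb)
include h

/-- `Hw` takes the same value at two adjacent sites of the arc `B` (they corner a common inner face,
on which `Hb` equals both values). [folklore] -/
theorem hw_eq_of_adj_zdArcB {b b' : Site 2} (hb : b ∈ (barDomain W N c).toDobrushin.zdArcB)
    (hb' : b' ∈ (barDomain W N c).toDobrushin.zdArcB) (hadj : (zdGraph 2).Adj b b') : Hw b = Hw b' := by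
  have hbS := (barDomain W N c).mem_S_of_mem_zdBoundary ((barDomain W N c).toDobrushin.zdArcB_subset_zdBoundary hb)
  have hb'S := (barDomain W N c).mem_S_of_mem_zdBoundary ((barDomain W N c).toDobrushin.zdArcB_subset_zdBoundary hb')
  obtain ⟨f, hf, hbf, hb'f⟩ := exists_isInnerFace_of_adj hbS hb'S hadj
  obtain ⟨k, rfl⟩ := exists_faceAt_of_isCorner hbf
  obtain ⟨k', hk'⟩ := exists_faceAt_of_isCorner hb'f
  have e1 := h.hb_eq_hw_of_mem_zdArcB hb hf
  rw [hk'] at hf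
  have e2 := h.hb_eq_hw_of_mem_zdArcB hb' hf
  rw [← hk'] at e2
  linarith

/-- `Hw` takes the same value at two adjacent sites of the bar (the `A`–`A` edge borders the inner
face below it). [folklore] -/
theorem hw_eq_of_adj_bar {a a' : Site 2} (ha : a ∈ (barDomain W N c).A) (ha' : a' ∈ (barDomain W N c).A)
    (hadj : (zdGraph 2).Adj a a') : Hw a = Hw a' := by
  obtain ⟨k, hk⟩ : ∃ k : Fin 4, a' = a + cornerUnit k := by
    obtain ⟨i, hi | hi⟩ := (zdGraph_adj_iff a a').1 hadj
    · fin_cases i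
      · exact ⟨0, hi⟩
      · exact ⟨1, hi⟩
    · fin_cases i
      · exact ⟨2, by rw [hi]; simp [cornerUnit]⟩
      · exact ⟨3, by rw [hi]; simp [cornerUnit]⟩
  subst hk
  have hA := zdArcA_barDomain (N := N) hc hcW
  have haA : a ∈ (barDomain W N c).toDobrushin.zdArcA := by rw [hA]; exact ha
  have ha'A : a + cornerUnit k ∈ (barDomain W N c).toDobrushin.zdArcA := by rw [hA]; exact ha'
  obtain ⟨f, hf, haf, ha'f⟩ := exists_isInnerFace_of_adj ((barDomain W N c).A_subset ha) ((barDomain W N c).A_subset ha') hadj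
  obtain ⟨j, rfl⟩ := exists_faceAt_of_isCorner haf
  rcases (isCorner_add_faceAt_iff a k j).1 ha'f with rfl | rfl
  · exact h.hw_eq_hw_of_arcA haA ha'A (Or.inl hf)
  · exact h.hw_eq_hw_of_arcA haA ha'A (Or.inr hf)

end Primitive

end LatticeDobrushin

end Literature.Probability.LatticeModels

namespace Literature.Probability.LatticeModels

open Finset Set SimpleGraph

namespace LatticeDobrushin

variable {W N : ℕ} {c : ℤ}

/-! ### The arc `B` of the bar domain is connected by lattice steps -/

/-- Every site of the arc `B` (the ring minus the bar) is joined inside `B` to the bottom-left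
corner `(-1, -1)` of the ring. [folklore] -/
theorem reflTransGen_zdArcB_barDomain (hc : 0 ≤ c) (hcW : c + 3 ≤ W) {b : Site 2}
    (hb : b ∈ (barDomain W N c).toDobrushin.zdArcB) :
    Relation.ReflTransGen (SiteStep (barDomain W N c).toDobrushin.zdArcB) b ![-1, -1] := by
  have hBeq := zdArcB_barDomain (N := N) hc hcW
  -- membership test for `B`
  have memB : ∀ x : Site 2, (-1 ≤ x 0 ∧ x 0 ≤ (W : ℤ) + 1 ∧ -1 ≤ x 1 ∧ x 1 ≤ (N : ℤ) + 1) →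
      (x 0 = -1 ∨ x 0 = (W : ℤ) + 1 ∨ x 1 = -1 ∨ x 1 = (N : ℤ) + 1) → ¬ (x 1 = N + 1 ∧ c ≤ x 0 ∧ x 0 ≤ c + 3) →
      x ∈ (barDomain W N c).toDobrushin.zdArcB := by
    intro x h1 h2 h3
    rw [hBeq]; exact ⟨mem_barDomain_S.2 h1, h2, h3⟩
  rw [hBeq] at hb
  obtain ⟨hbS, hring, hnot⟩ := hb
  rw [mem_barDomain_S] at hbS
  -- walks along the four sides
  -- (i) bottom row: from `x` with `x 1 = -1` go left to the corner
  have bottom : ∀ x : Site 2, (-1 ≤ x 0 ∧ x 0 ≤ (W : ℤ) + 1) → x 1 = -1 →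
      Relation.ReflTransGen (SiteStep (barDomain W N c).toDobrushin.zdArcB) x ![-1, -1] := by
    intro x hx0 hx1
    have hw := reflTransGen_siteStep_line_neg (T := (barDomain W N c).toDobrushin.zdArcB) x 0 (x 0 + 1).toNat fun k hk => by
      have := Int.toNat_of_nonneg (show (0 : ℤ) ≤ x 0 + 1 by omega)
      refine memB _ ?_ ?_ ?_ <;> simp <;> omega
    have e : x - (((x 0 + 1).toNat : ℕ) : ℤ) • (Pi.single 0 1 : Site 2) = ![-1, -1] := by
      have := Int.toNat_of_nonneg (show (0 : ℤ) ≤ x 0 + 1 by omega)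
      funext j; fin_cases j <;> simp <;> omega
    rwa [e] at hw
  -- (ii) left column: go down
  have left : ∀ x : Site 2, x 0 = -1 → (-1 ≤ x 1 ∧ x 1 ≤ (N : ℤ) + 1) →
      Relation.ReflTransGen (SiteStep (barDomain W N c).toDobrushin.zdArcB) x ![-1, -1] := by
    intro x hx0 hx1
    have hw := reflTransGen_siteStep_line_neg (T := (barDomain W N c).toDobrushin.zdArcB) x 1 (x 1 + 1).toNat fun k hk => by
      have := Int.toNat_of_nonneg (show (0 : ℤ) ≤ x 1 + 1 by omega)
      refine memB _ ?_ ?_ ?_ <;> simp <;> omega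
    have e : x - (((x 1 + 1).toNat : ℕ) : ℤ) • (Pi.single 1 1 : Site 2) = ![-1, -1] := by
      have := Int.toNat_of_nonneg (show (0 : ℤ) ≤ x 1 + 1 by omega)
      funext j; fin_cases j <;> simp <;> omega
    rwa [e] at hw
  -- (iii) right column: go down to `(W+1, -1)`, then along the bottom
  have right : ∀ x : Site 2, x 0 = (W : ℤ) + 1 → (-1 ≤ x 1 ∧ x 1 ≤ (N : ℤ) + 1) →
      Relation.ReflTransGen (SiteStep (barDomain W N c).toDobrushin.zdArcB) x ![-1, -1] := by
    intro x hx0 hx1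
    have hw := reflTransGen_siteStep_line_neg (T := (barDomain W N c).toDobrushin.zdArcB) x 1 (x 1 + 1).toNat fun k hk => by
      have := Int.toNat_of_nonneg (show (0 : ℤ) ≤ x 1 + 1 by omega)
      refine memB _ ?_ ?_ ?_ <;> simp <;> omega
    have e : x - (((x 1 + 1).toNat : ℕ) : ℤ) • (Pi.single 1 1 : Site 2) = ![(W : ℤ) + 1, -1] := by
      have := Int.toNat_of_nonneg (show (0 : ℤ) ≤ x 1 + 1 by omega)
      funext j; fin_cases j <;> simp <;> omega
    rw [e] at hw
    exact hw.trans (bottom _ ⟨by simp; omega, by simp⟩ (by simp))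
  rcases hring with h0 | h0 | h1 | h1
  · exact left b h0 ⟨hbS.2.2.1, hbS.2.2.2⟩
  · exact right b h0 ⟨hbS.2.2.1, hbS.2.2.2⟩
  · exact bottom b ⟨hbS.1, hbS.2.1⟩ h1
  · -- top row, off the bar: left part goes left to `(-1, N+1)`, right part goes right to `(W+1, N+1)`
    by_cases hlt : b 0 < c
    · have hw := reflTransGen_siteStep_line_neg (T := (barDomain W N c).toDobrushin.zdArcB) b 0 (b 0 + 1).toNat fun k hk => by
        have := Int.toNat_of_nonneg (show (0 : ℤ) ≤ b 0 + 1 by omega)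
        refine memB _ ?_ ?_ ?_ <;> simp <;> omega
      have e : b - (((b 0 + 1).toNat : ℕ) : ℤ) • (Pi.single 0 1 : Site 2) = ![-1, (N : ℤ) + 1] := by
        have := Int.toNat_of_nonneg (show (0 : ℤ) ≤ b 0 + 1 by omega)
        funext j; fin_cases j <;> simp <;> omega
      rw [e] at hw
      exact hw.trans (left _ (by simp) ⟨by simp; omega, by simp⟩)
    · have hge : c + 4 ≤ b 0 := by omega
      have hw := reflTransGen_siteStep_line (T := (barDomain W N c).toDobrushin.zdArcB) b 0 ((W : ℤ) + 1 - b 0).toNat fun k hk => by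
        have := Int.toNat_of_nonneg (show (0 : ℤ) ≤ (W : ℤ) + 1 - b 0 by omega)
        refine memB _ ?_ ?_ ?_ <;> simp <;> omega
      have e : b + ((((W : ℤ) + 1 - b 0).toNat : ℕ) : ℤ) • (Pi.single 0 1 : Site 2) = ![(W : ℤ) + 1, (N : ℤ) + 1] := by
        have := Int.toNat_of_nonneg (show (0 : ℤ) ≤ (W : ℤ) + 1 - b 0 by omega)
        funext j; fin_cases j <;> simp <;> omega
      rw [e] at hw
      exact hw.trans (right _ (by simp) ⟨by simp; omega, by simp⟩)

/-- Every site of the bar is joined inside the bar to its left end `(c, N+1)`. [folklore] -/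
theorem reflTransGen_bar (hc : 0 ≤ c) {a : Site 2} (ha : a ∈ (barDomain W N c).A) :
    Relation.ReflTransGen (SiteStep (barDomain W N c).A) a ![c, (N : ℤ) + 1] := by
  obtain ⟨⟨h0, h0', h1, h1'⟩, h1'', hca, hca'⟩ := mem_barDomain_A.1 ha
  have hw := reflTransGen_siteStep_line_neg (T := (barDomain W N c).A) a 0 (a 0 - c).toNat fun k hk => by
    rw [mem_barDomain_A]
    have hk' : (k : ℤ) ≤ a 0 - c := by
      have := Int.toNat_of_nonneg (show (0 : ℤ) ≤ a 0 - c by omega); omega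
    simp only [Pi.sub_apply, Pi.smul_apply, Pi.single_apply, h1'']
    simp
    omega
  have e : a - (((a 0 - c).toNat : ℕ) : ℤ) • (Pi.single 0 1 : Site 2) = ![c, (N : ℤ) + 1] := by
    have := Int.toNat_of_nonneg (show (0 : ℤ) ≤ a 0 - c by omega)
    funext j; fin_cases j
    · simp; omega
    · simp [h1'']
  rwa [e] at hw

section Levels

variable (hc : 0 ≤ c) (hcW : c + 3 ≤ W) {Hw Hb : Site 2 → ℝ}
  (h : IsFKPrimitive (barDomain W N c).toDobrushin (isZdAdmissible_barDomain hc hcW) Hw Hb)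
include h

/-- **`Hw` is constant on the arc `B` of the bar domain.** [folklore] -/
theorem hw_eq_of_mem_zdArcB {b b' : Site 2} (hb : b ∈ (barDomain W N c).toDobrushin.zdArcB)
    (hb' : b' ∈ (barDomain W N c).toDobrushin.zdArcB) : Hw b = Hw b' := by
  have key : ∀ x y : Site 2, Relation.ReflTransGen (SiteStep (barDomain W N c).toDobrushin.zdArcB) x y →
      x ∈ (barDomain W N c).toDobrushin.zdArcB → Hw x = Hw y := by
    intro x y hxy hx
    induction hxy with
    | refl => rfl
    | tail _ hst ih => rw [ih, hw_eq_of_adj_zdArcB hc hcW h hst.2.1 hst.2.2 hst.1]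
  rw [key b _ (reflTransGen_zdArcB_barDomain hc hcW hb) hb, key b' _ (reflTransGen_zdArcB_barDomain hc hcW hb') hb']

/-- **`Hw` is constant on the bar.** [folklore] -/
theorem hw_eq_of_mem_bar {a a' : Site 2} (ha : a ∈ (barDomain W N c).A) (ha' : a' ∈ (barDomain W N c).A) : Hw a = Hw a' := by
  have key : ∀ x y : Site 2, Relation.ReflTransGen (SiteStep (barDomain W N c).A) x y → x ∈ (barDomain W N c).A → Hw x = Hw y := by
    intro x y hxy hx
    induction hxy with
    | refl => rfl
    | tail _ hst ih => rw [ih, hw_eq_of_adj_bar hc hcW h hst.2.1 hst.2.2 hst.1]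
  rw [key a _ (reflTransGen_bar hc ha) ha, key a' _ (reflTransGen_bar hc ha') ha']

/-- The wired level `H_A = Hw (start vertex)` is the value of `Hw` on the whole bar. [folklore] -/
theorem hcA_barDomain : ∀ a ∈ (barDomain W N c).toDobrushin.zdArcA, (∃ k, (barDomain W N c).toDobrushin.IsInnerFace (faceAt a k)) →
    Hw a = Hw (DiscreteDobrushin.startCorner (isZdAdmissible_barDomain (N := N) hc hcW)).1 := by
  intro a ha _
  have hc₀ := DiscreteDobrushin.isStartCorner_startCorner (isZdAdmissible_barDomain (N := N) hc hcW)
  rw [zdArcA_barDomain hc hcW] at ha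
  have h0 : (DiscreteDobrushin.startCorner (isZdAdmissible_barDomain (N := N) hc hcW)).1 ∈ (barDomain W N c).A := by
    have := hc₀.mem_zdArcA; rwa [zdArcA_barDomain hc hcW] at this
  exact hw_eq_of_mem_bar hc hcW h ha h0

/-- The free level `H_B = Hw (B-end of the start edge)` is the value of `Hw` on the whole arc `B`. [folklore] -/
theorem hcB_barDomain : ∀ b ∈ (barDomain W N c).toDobrushin.zdArcB, (∃ k, (barDomain W N c).toDobrushin.IsInnerFace (faceAt b k)) →
    Hw b = Hw ((DiscreteDobrushin.startCorner (isZdAdmissible_barDomain (N := N) hc hcW)).1 +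
      cornerUnit (DiscreteDobrushin.startCorner (isZdAdmissible_barDomain (N := N) hc hcW)).2) := by
  intro b hb _
  have hc₀ := DiscreteDobrushin.isStartCorner_startCorner (isZdAdmissible_barDomain (N := N) hc hcW)
  exact hw_eq_of_mem_zdArcB hc hcW h hb hc₀.mem_zdArcB

/-- **The two levels differ by one**: `H_B = H_A + 1`. [cite: Smirnov2010, Lemma 4.11] -/
theorem levelB_eq : Hw ((DiscreteDobrushin.startCorner (isZdAdmissible_barDomain (N := N) hc hcW)).1 +
      cornerUnit (DiscreteDobrushin.startCorner (isZdAdmissible_barDomain (N := N) hc hcW)).2) =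
    Hw (DiscreteDobrushin.startCorner (isZdAdmissible_barDomain (N := N) hc hcW)).1 + 1 :=
  h.jump_startCorner

end Levels

end LatticeDobrushin

end Literature.Probability.LatticeModels

namespace Literature.Probability.LatticeModels

open Finset Set SimpleGraph

namespace LatticeDobrushin

variable {W N : ℕ} {c : ℤ}

/-! ### The source term under the bar: `H_B - Hb ≥ (1-τ)/(4-τ)` at the three window faces -/

section Window

variable (hc : 0 ≤ c) (hcW : c + 3 ≤ W) {Hw Hb : Site 2 → ℝ}
  (h : IsFKPrimitive (barDomain W N c).toDobrushin (isZdAdmissible_barDomain hc hcW) Hw Hb)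
include h

/-- Notation-free abbreviations for the two levels. -/
local notation "c₀" => DiscreteDobrushin.startCorner (isZdAdmissible_barDomain (W := W) (N := N) (c := c) hc hcW)

/-- **`Hb ≤ H_B` on every inner face of the bar domain.** [cite: Smirnov2010, proof of Lemma 5.2] -/
theorem hb_le_levelB {f : Site 2} (hf : (barDomain W N c).toDobrushin.IsInnerFace f) :
    Hb f ≤ Hw ((c₀).1 + cornerUnit (c₀).2) :=
  h.hb_le (preconnected_zdArcA_barDomain hc hcW) (hcA_barDomain hc hcW h) (hcB_barDomain hc hcW h) hf

/-- **`H_A ≤ Hw`** at every site cornering an inner face. [cite: Smirnov2010, proof of Lemma 5.2] -/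
theorem levelA_le_hw {v : Site 2} (hv : ∃ k, (barDomain W N c).toDobrushin.IsInnerFace (faceAt v k)) : Hw (c₀).1 ≤ Hw v :=
  h.le_hw (preconnected_zdArcA_barDomain hc hcW) (hcA_barDomain hc hcW h) (hcB_barDomain hc hcW h) hv

/-- **The source term at a window face.** At each of the three faces `F = (c+j, N)`, `j = 0, 1, 2`,
between the top side of `R` and the bar, `H_B - Hb(F) ≥ (1 - τ)/(4 - τ)` with `τ = tan²(π/8) =
(√2 - 1)²`: the black phantom inequality at `F` (its top side is an `A`–`A` edge, its three other
sides are interior), combined with `Hb ≤ H_B` at the three inner neighbours and `Hw = H_A = H_B - 1`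
on the bar. This is the boundary datum "`H̃_∘ = 1` on the extra layer along the wired arc" of
Duminil-Copin–Hongler–Nolin's Proposition 8, quantified. [cite: DuminilCopinHonglerNolin2011, §3.1, Proposition 8] -/
theorem window_source {F : Site 2} (hF1 : F 1 = N) (hF0 : c ≤ F 0 ∧ F 0 ≤ c + 2) :
    (1 - (Real.sqrt 2 - 1) ^ 2) / (4 - (Real.sqrt 2 - 1) ^ 2) ≤ Hw ((c₀).1 + cornerUnit (c₀).2) - Hb F := by
  set hE := isZdAdmissible_barDomain (W := W) (N := N) (c := c) hc hcW
  have hA := preconnected_zdArcA_barDomain (N := N) hc hcW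
  have hAeq := zdArcA_barDomain (N := N) hc hcW
  -- the face and its neighbours are inner
  have hF : (barDomain W N c).toDobrushin.IsInnerFace F := isInnerFace_barDomain_iff.2 (by omega)
  -- interior sides `0, 1, 3`
  have hint : ∀ j : Fin 4, j ∉ ({2} : Finset (Fin 4)) → (barDomain W N c).toDobrushin.IsInteriorEdge (F + cornerOff j) j := by
    intro j hj
    rw [Finset.mem_singleton] at hj
    fin_cases j
    · exact isInteriorEdge_barDomain hc hcW (by simp [cornerOff]; omega) (Or.inl (by simp [cornerOff, cornerUnit]; omega))
    · refine isInteriorEdge_barDomain hc hcW (by simp [cornerOff]; omega) (Or.inr ?_)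
      rw [mem_barDomain_A]; simp [cornerOff, cornerUnit]; omega
    · exact absurd rfl hj
    · -- the left side, from the bar site `F + e₁` downwards: reverse of the upward edge at `F`
      have hup : (barDomain W N c).toDobrushin.IsInteriorEdge F 1 := by
        refine isInteriorEdge_barDomain hc hcW (by omega) (Or.inr ?_)
        rw [mem_barDomain_A]; simp [cornerUnit]; omega
      have := hup.reverse
      have e : F + cornerUnit 1 = F + cornerOff 3 := by simp [cornerUnit, cornerOff]
      rw [e] at this
      exact this
  have hph : ∀ j ∈ ({2} : Finset (Fin 4)), F + cornerOff j ∈ (barDomain W N c).toDobrushin.zdArcA ∧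
      F + cornerOff j + cornerUnit j ∈ (barDomain W N c).toDobrushin.zdArcA := by
    intro j hj
    rw [Finset.mem_singleton] at hj
    subst hj
    rw [hAeq]
    constructor
    · rw [mem_barDomain_A]; simp [cornerOff]; omega
    · rw [mem_barDomain_A]; simp [cornerOff, cornerUnit]; omega
  have hpair : ∀ j : Fin 4, Hb F - Hw (F + cornerOff j) = dartFlux (barDomain W N c).toDobrushin hE (F + cornerOff j, j) := by
    intro j
    have := h (F + cornerOff j, j) (by change (barDomain W N c).toDobrushin.IsInnerFace (faceAt (F + cornerOff j) j); rw [faceAt_add_cornerOff]; exact hF)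
    simp only [cFace] at this
    rwa [faceAt_add_cornerOff] at this
  have hnbr : ∀ j : Fin 4, j ∉ ({2} : Finset (Fin 4)) → (barDomain W N c).toDobrushin.IsInnerFace (F + cornerUnit (j + 3)) := by
    intro j hj
    rw [Finset.mem_singleton] at hj
    rw [isInnerFace_barDomain_iff]
    fin_cases j <;> simp [cornerUnit] at hj ⊢ <;> omega
  have hpair' : ∀ j : Fin 4, j ∉ ({2} : Finset (Fin 4)) →
      Hb (F + cornerUnit (j + 3)) - Hw (F + cornerOff j) = dartFlux (barDomain W N c).toDobrushin hE (F + cornerOff j, j + 3) := by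
    intro j hj
    have := h (F + cornerOff j, j + 3) (by
      change (barDomain W N c).toDobrushin.IsInnerFace (faceAt (F + cornerOff j) (j + 3)); rw [faceAt_face_corner_add_three]; exact hnbr j hj)
    simp only [cFace] at this
    rwa [faceAt_face_corner_add_three] at this
  have key := phantom_laplacian_hb hE hA F hF {2} hint hph hpair hpair'
  -- evaluate: neighbours `≤ H_B`, bar value `= H_A = H_B - 1`
  set β := Hw ((c₀).1 + cornerUnit (c₀).2) with hβ
  have hα : Hw (F + cornerOff 2) = β - 1 := by
    have h1 := hcA_barDomain hc hcW h (F + cornerOff 2) (hph 2 (Finset.mem_singleton_self _)).1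
      ⟨2, by rw [faceAt_add_cornerOff]; exact hF⟩
    have h2 := levelB_eq (N := N) hc hcW h
    rw [h1]; linarith
  have hsum1 : ∑ j ∈ univ.filter (· ∉ ({2} : Finset (Fin 4))), (Hb (F + cornerUnit (j + 3)) - Hb F) ≤ 3 * (β - Hb F) := by
    have hle : ∀ j ∈ univ.filter (· ∉ ({2} : Finset (Fin 4))), Hb (F + cornerUnit (j + 3)) - Hb F ≤ β - Hb F := by
      intro j hj
      rw [Finset.mem_filter] at hj
      have := hb_le_levelB hc hcW h (hnbr j hj.2)
      linarith
    refine (Finset.sum_le_sum hle).trans ?_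
    rw [Finset.sum_const]
    have : (univ.filter (· ∉ ({2} : Finset (Fin 4)))).card = 3 := by decide
    rw [this, nsmul_eq_mul]; norm_num
  have hsum2 : ∑ j ∈ ({2} : Finset (Fin 4)), (Hb F - Hw (F + cornerOff j)) = Hb F - (β - 1) := by
    rw [Finset.sum_singleton, hα]
  rw [hsum2] at key
  have hτ : (Real.sqrt 2 - 1) ^ 2 < 1 := by
    have h1 : Real.sqrt 2 < 2 := by
      rw [show (2 : ℝ) = Real.sqrt 4 by rw [show (4 : ℝ) = 2 ^ 2 by norm_num, Real.sqrt_sq (by norm_num)]]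
      exact Real.sqrt_lt_sqrt (by norm_num) (by norm_num)
    have h2 : 1 < Real.sqrt 2 := by
      rw [show (1 : ℝ) = Real.sqrt 1 by simp]
      exact Real.sqrt_lt_sqrt (by norm_num) (by norm_num)
    nlinarith
  rw [div_le_iff₀ (by linarith)]
  nlinarith [hsum1, key, hτ]

end Window

end LatticeDobrushin

end Literature.Probability.LatticeModels

namespace Literature.Probability.LatticeModels

open Finset Set SimpleGraph

/-! ### From the flux at a `B`-side dart to the connection probability (DCHN Lemma 12, lower half) -/

namespace DiscreteDobrushin

variable {D : DiscreteDobrushin}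

/-- **The open-connection event**: the vertex `x` of `Ω_δ` is joined to (a vertex over) the wired
arc `A` by a path of `ω`-open edges of the interface graph (the graph of the FK Dobrushin measure:
`Ω_δ` minus the edges touching the free arc `B`). [cite: DuminilCopinHonglerNolin2011, §3.2, Lemma 12] -/
def OpenJoinedToArcA (D : DiscreteDobrushin) (x : meshDomain D.Ω D.δ) (ω : Percolation.BondConfig (Site 2)) : Prop :=
  ∃ b : meshDomain D.Ω D.δ, b.val ∈ D.zdArcA ∧
    (SimpleGraph.fromEdgeSet {e' : Sym2 (meshDomain D.Ω D.δ) | e' ∈ D.interfaceGraph.edgeSet ∧ Sym2.map Subtype.val e' ∈ ω}).Reachable x b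

/-- **If the interface passes through the medial vertex of an edge `{x, b}` with `b` on the free
arc, then `x` is joined to the wired arc by open edges**: the orbit corner carrying that passage
has primal vertex `x` (primal vertices of the exploration are never on `B`), so `x` is an explored
wired vertex, and explored wired vertices hang off the arc `A` by revealed open edges.
[cite: DuminilCopinHonglerNolin2011, §3.2, Lemma 12; DuminilCopinSmirnov2012Clay, §6.2] -/
theorem openJoinedToArcA_of_mem_fkInterface (hD : D.IsZdAdmissible) [Fintype (meshDomain D.Ω D.δ)]
    (q : Site 2 × Fin 4) (hqB : q.1 + cornerUnit q.2 ∈ D.zdArcB) (hx : q.1 ∈ meshDomain D.Ω D.δ)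
    {ω : Percolation.BondConfig (Site 2)} (h : cSrc q ∈ fkInterface D ω) : OpenJoinedToArcA D ⟨q.1, hx⟩ ω := by
  classical
  change cSrc q ∈ medialExploration D ω at h
  rw [medialExploration_eq_explorationList hD, explorationList, List.mem_map] at h
  obtain ⟨i, hi, hiq⟩ := h
  rw [List.mem_range] at hi
  set N := exitTime hD ω
  -- the primal vertex of the `i`-th corner is `q.1`
  have hfst : (cornerOrbit (D.bcBondConfig ω) (startCorner hD) i).1 = q.1 := by
    have hmem : (cornerOrbit (D.bcBondConfig ω) (startCorner hD) i).1 ∈ cSrc q := by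
      rw [← hiq, cSrc]; exact Sym2.mem_mk_left _ _
    rw [cSrc, Sym2.mem_iff] at hmem
    rcases hmem with h1 | h1
    · exact h1
    · exact absurd (h1 ▸ hqB) (cornerOrbit_fst_not_mem_zdArcB hD (isStartCorner_startCorner hD) ω i)
  have hxW : (⟨q.1, hx⟩ : meshDomain D.Ω D.δ) ∈ exploredWired hD ω N :=
    Or.inr ⟨i, by rw [Nat.min_self]; omega, hfst.symm⟩
  obtain ⟨b, hb, hreach⟩ := exists_reachable_of_mem_exploredWired hxW
  refine ⟨b, hb, hreach.mono (SimpleGraph.fromEdgeSet_mono ?_)⟩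
  intro e' he'
  rw [Finset.mem_coe, mem_revealedOpenEdges_iff] at he'
  exact ⟨SimpleGraph.mem_edgeFinset.1 (revealedEdges_subset ω N he'.1), he'.2⟩

/-- **DCHN's Lemma 12, lower half, at the level of fluxes**: the flux of the primitive across a
dart whose edge ends on the free arc is at most the square of the probability that its primal
vertex is joined to the wired arc: `|F(e)|² ≤ P(e ∈ γ)² ≤ P(x ↔ A)²`.
[cite: DuminilCopinHonglerNolin2011, §3.2, Lemma 12] -/
theorem dartFlux_le_openJoined_sq (hD : D.IsZdAdmissible) [Fintype (meshDomain D.Ω D.δ)]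
    (q : Site 2 × Fin 4) (hqB : q.1 + cornerUnit q.2 ∈ D.zdArcB) (hx : q.1 ∈ meshDomain D.Ω D.δ) :
    dartFlux D hD q ≤ ((fkDobrushinMeasure D).real {ω | OpenJoinedToArcA D ⟨q.1, hx⟩ ω}) ^ 2 := by
  refine (dartFlux_le_passageProb_sq hD q).trans ?_
  have hmono : (fkDobrushinMeasure D).real {ω | cSrc q ∈ fkInterface D ω} ≤
      (fkDobrushinMeasure D).real {ω | OpenJoinedToArcA D ⟨q.1, hx⟩ ω} :=
    MeasureTheory.measureReal_mono (fun ω hω => openJoinedToArcA_of_mem_fkInterface hD q hqB hx hω)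
  exact pow_le_pow_left₀ MeasureTheory.measureReal_nonneg hmono 2

end DiscreteDobrushin

namespace LatticeDobrushin

variable {W N : ℕ} {c : ℤ}

section FluxAtBottom

variable (hc : 0 ≤ c) (hcW : c + 3 ≤ W) {Hw Hb : Site 2 → ℝ}
  (h : IsFKPrimitive (barDomain W N c).toDobrushin (isZdAdmissible_barDomain hc hcW) Hw Hb)
include h

local notation "c₀" => DiscreteDobrushin.startCorner (isZdAdmissible_barDomain (W := W) (N := N) (c := c) hc hcW)

/-- **The flux at a bottom dart dominates `H_B - Hb`.** For a site `x = (x₁, 0)` on the bottom row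
of `R`, the dart `(x, 3)` (edge from `x` down to `b = (x₁, -1) ∈ B`, face `(x₁, -1)` on its left)
has flux `Hb(x₁, -1) - Hw(x) = H_B - Hw(x) ≥ H_B - Hb(x₁, 0)` (`Hb = H_B` on faces cornered by
`B`, `Hw ≤ Hb` across the face above). [cite: DuminilCopinHonglerNolin2011, §3.2, Lemma 12 and §4, Proposition 13] -/
theorem levelB_sub_hb_le_dartFlux {x : Site 2} (hx0 : 0 ≤ x 0 ∧ x 0 ≤ (W : ℤ)) (hx1 : x 1 = 0) :
    Hw ((c₀).1 + cornerUnit (c₀).2) - Hb x ≤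
      dartFlux (barDomain W N c).toDobrushin (isZdAdmissible_barDomain hc hcW) (x, 3) := by
  have hxR : 0 ≤ x 0 ∧ x 0 ≤ (W : ℤ) ∧ 0 ≤ x 1 ∧ x 1 ≤ (N : ℤ) := by omega
  -- the face on the left of the dart is `faceAt x 3 = (x₁, -1)`, inner and cornered by `b = x + cornerUnit 3 ∈ B`
  have hinner : (barDomain W N c).toDobrushin.IsInnerFace (faceAt x 3) := isInnerFace_faceAt_barDomain hxR 3
  have hbB : x + cornerUnit 3 ∈ (barDomain W N c).toDobrushin.zdArcB := by
    rw [zdArcB_barDomain hc hcW]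
    refine ⟨mem_barDomain_S.2 ?_, ?_, ?_⟩ <;> simp [cornerUnit] <;> omega
  have hflux := h (x, 3) hinner
  simp only [cFace] at hflux
  -- `Hb (faceAt x 3) = Hw b = H_B`
  obtain ⟨k', hk'⟩ := exists_faceAt_of_isCorner ((isCorner_add_faceAt_iff x 3 3).2 (Or.inl rfl))
  have hHb : Hb (faceAt x 3) = Hw ((c₀).1 + cornerUnit (c₀).2) := by
    rw [hk', h.hb_eq_hw_of_mem_zdArcB hbB (hk' ▸ hinner)]
    exact hcB_barDomain hc hcW h _ hbB ⟨k', hk' ▸ hinner⟩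
  -- `Hw x ≤ Hb (faceAt x 0) = Hb x`
  have hwb : Hw x ≤ Hb x := by
    have f0 : faceAt x 0 = x := by simp [faceAt, cornerOff]
    have := h.hw_le_hb (v := x) (k := 0) (isInnerFace_faceAt_barDomain hxR 0)
    rwa [f0] at this
  linarith

end FluxAtBottom

end LatticeDobrushin

end Literature.Probability.LatticeModels
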